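import Literature.AnabelianGeometry.SemiGraphs.TemperedPiBranchStabilizerImage
import Literature.AnabelianGeometry.SemiGraphs.TemperedPiLevelKernelVertGen
import Mathlib.GroupTheory.OrderOfElement
import HarnessLib

/-!
# Edge stabilisers at a level-tree vertex are ONE cyclic image: the re-centred branch-stabiliser
# dictionary, uniform point stabilisers of a Galois level, and the edge-group transfer
# ([SemiAnbd] Rmk 2.2.1 p. 24, Thm 3.7 (iii)/(iv) p. 41)

Mochizuki, *Semi-graphs of anabelioids*, Publ. RIMS **42** (2006) [MochizukiSemiAnbd2006], Remark 2.2.1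
p. 24 ("the image of each `Π_b` in `Π_𝒢` is equal to the stabilizer of a compatible system of edges") and the
proof of Theorem 3.7 (iii)/(iv) p. 41. [cite: MochizukiSemiAnbd2006, Rmk 2.2.1 p.24]

PROOF-ONLY file (abc-iut cell, F-wave seat abc-iut-f-175 gen 2; FRONTIER programme REFUTE-F1732 follow-up
«the escaping procyclic `C` of `𝒢_θ` is ITSELF maximal compact», towards the kernel decision of the
∀-countable typed forms F-2770 `QuasiGeometricGraphDataCompat` / F-2771 `Cor39Compat`; no definitions, no
named facts).  Generic one-level lemmas over abc-iut-L3-t9's Galois tower `D : GaloisLevelData 𝒢`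
(`π₁^temp(𝒢) = lim_n Gal(𝒢_{∞,n}/𝒢)`) in the currency of abc-iut-L3-t6's point sequences:

* `ρ_eq_self_iff_of_cover` — in the fibre of `𝒢_{∞,n}` over a vertex `w` ALL points have the same
  stabiliser in `Π_w` (the endomorphisms of `𝒢_{∞,n}` are transitive on fibres and `Π_w`-equivariant); hence
  `PointSeq.gal_eq_one_iff_gal_eq_one` / `PointSeq.orderOf_gal_eq`: the kernel of `h ↦ σ_n^h`, and the order of
  `σ_n^h`, do not depend on the point sequence over `w`;
* `PointSeq.gal_brHom_eq_one_iff_ρE` — transfer through the gluing: `σ_n^{b_*(t)} = 1` iff `t ∈ Π_e` fixes a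
  (any) point of the edge fibre `(𝒢_{∞,n})_e` — so the two branches of one edge give the SAME condition on `t`;
* `PointSeq.exists_pointSeq_forall_stab_branch` / `…_forall_fix_edge` — abc-iut-L3-t11's local
  branch-stabiliser lemma `exists_gal_conj_brHom_of_edgeMap_eq` RE-CENTRED: after translating the point
  sequence to the point through which the fixed branch passes, the conjugator disappears — EVERY element of
  `π₁^temp` fixing the edge of the branch `β` at `P.vertex n` over `b` has level-`n` component `σ_n^{b_*(k)}`
  for the SAME point sequence `P'` (the whole stabiliser lies in the image of ONE copy of `Π_b`);
* (private `range_eq_zpowers_of_dense` — a continuous homomorphism from a topologically cyclic group into a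
  discrete group has cyclic range); `mem_topologicalClosure_of_forall_proj` — level-wise membership in a subgroup of
  `π₁^temp` gives membership in its closure.

Nothing here bears on [IUTchIII] Cor. 3.12; typed ≠ proved.
-/

namespace Literature.AnabelianGeometry.SemiGraphs

open CategoryTheory Topology

universe u

/-! ### A continuous homomorphism from a topologically cyclic group into a discrete group -/

/-- **The range of a continuous homomorphism from a topologically cyclic group into a discrete group is
the cyclic group generated by the image of the topological generator** (the image of the closure lies in
the closure of the image, which is closed in a discrete group). [folklore] -/
private theorem MonoidHom.range_eq_zpowers_of_dense {E : Type*} [Group E] [TopologicalSpace E]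
    [IsTopologicalGroup E] {Γ : Type*}
    [Group Γ] [TopologicalSpace Γ] [DiscreteTopology Γ] (e₀ : E)
    (hgen : (Subgroup.zpowers e₀).topologicalClosure = ⊤) (τ : E →* Γ) (hτ : Continuous τ) :
    τ.range = Subgroup.zpowers (τ e₀) := by
  apply le_antisymm
  · rintro _ ⟨t, rfl⟩
    have ht : t ∈ (Subgroup.zpowers e₀).topologicalClosure := by rw [hgen]; exact Subgroup.mem_top t
    have h1 : τ t ∈ closure (τ '' (Subgroup.zpowers e₀ : Set E)) :=
      image_closure_subset_closure_image hτ ⟨t, ht, rfl⟩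
    have h2 : τ '' (Subgroup.zpowers e₀ : Set E) = (Subgroup.zpowers (τ e₀) : Set Γ) := by
      rw [← Subgroup.coe_map, MonoidHom.map_zpowers]
    rw [h2, (isClosed_discrete (Subgroup.zpowers (τ e₀) : Set Γ)).closure_eq] at h1
    exact h1
  · rw [← MonoidHom.map_zpowers]
    exact Subgroup.map_le_range τ _

namespace ProfiniteSemiGraph

namespace GaloisLevelData

open Literature.AlgebraicGeometry.Frobenioids.QuasiTemperoid.BTempConnected (ρ_one_apply
  ρ_mul_apply ρ_inv_apply)

variable {𝒢 : ProfiniteSemiGraph.{u}} (D : GaloisLevelData 𝒢) (h𝒢 : 𝒢.IsCountable)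

/-! ### Uniform point stabilisers of a Galois level -/

/-- **All points of the fibre of `𝒢_{∞,n}` over `v` have the same stabiliser in `Π_v`**: the
endomorphisms of `𝒢_{∞,n}` act transitively on the fibre (`cover_htrans`) and commute with `Π_v`.
[cite: MochizukiSemiAnbd2006, Prop 3.6 p.38] -/
theorem ρ_eq_self_iff_of_cover (n : ℕ) (v : 𝒢.graph.Vertex) (h : 𝒢.Gv v)
    (t t' : ((D.cover h𝒢 n).SV v).obj.V) :
    ((D.cover h𝒢 n).SV v).obj.ρ h t = t ↔ ((D.cover h𝒢 n).SV v).obj.ρ h t' = t' := by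
  constructor
  · intro ht
    obtain ⟨σ, hσ⟩ := D.cover_htrans h𝒢 n v t t'
    rw [← hσ, ← CovHom.fV_ρ, ht]
  · intro ht
    obtain ⟨σ, hσ⟩ := D.cover_htrans h𝒢 n v t' t
    rw [← hσ, ← CovHom.fV_ρ, ht]

/-- **Level-wise membership gives membership in the closure**: if every level-`n` component of `k` is the
component of some element of the subgroup `H ⊆ π₁^temp(𝒢)`, then `k` lies in the closure of `H` (the level
kernels `ker ρ_n` form a basis of neighbourhoods of `1`). [cite: MochizukiSemiAnbd2006, Prop 3.6(i) p.38] -/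
theorem mem_topologicalClosure_of_forall_proj (H : Subgroup (D.temperedPi h𝒢)) (k : D.temperedPi h𝒢)
    (hk : ∀ n, ∃ s ∈ H, D.proj h𝒢 n s = D.proj h𝒢 n k) : k ∈ H.topologicalClosure := by
  change k ∈ closure (H : Set (D.temperedPi h𝒢))
  rw [mem_closure_iff_nhds]
  intro t ht
  have hU : (fun g : D.temperedPi h𝒢 => k * g) ⁻¹' t ∈ 𝓝 (1 : D.temperedPi h𝒢) := by
    have hc : Continuous fun g : D.temperedPi h𝒢 => k * g := continuous_const.mul continuous_id
    refine hc.continuousAt.preimage_mem_nhds ?_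
    rwa [mul_one]
  obtain ⟨m, hm⟩ := D.exists_ker_projAut_subset h𝒢 hU
  obtain ⟨s, hs, hsm⟩ := hk m
  refine ⟨s, ?_, hs⟩
  have h1 : k⁻¹ * s ∈ ((D.projAut h𝒢 m).ker : Set (D.temperedPi h𝒢)) := by
    rw [SetLike.mem_coe, MonoidHom.mem_ker, map_mul, map_inv, D.projAut_apply, D.projAut_apply, hsm,
      inv_mul_cancel]
  have h2 := hm h1
  rw [Set.mem_preimage, mul_inv_cancel_left] at h2
  exact h2

namespace PointSeq

variable {D h𝒢} {w : 𝒢.graph.Vertex} (P : D.PointSeq h𝒢 w)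

/-- **The kernel of `h ↦ σ_n^h` does not depend on the point sequence over `w`** (it is the common
stabiliser of the points of the fibre of `𝒢_{∞,n}` over `w`). [cite: MochizukiSemiAnbd2006, Thm 3.7(i) p.40] -/
theorem gal_eq_one_iff_gal_eq_one (P' : D.PointSeq h𝒢 w) (n : ℕ) (h : 𝒢.Gv w) :
    P.gal n h = 1 ↔ P'.gal n h = 1 := by
  rw [P.gal_eq_one_iff, P'.gal_eq_one_iff]
  exact D.ρ_eq_self_iff_of_cover h𝒢 n w h (P.pt n) (P'.pt n)

/-- `σ_n^{h^m} = (σ_n^h)^m` (the decomposition map at level `n` is a homomorphism).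
[cite: MochizukiSemiAnbd2006, Thm 3.7(i) p.40] -/
theorem gal_pow (n : ℕ) (h : 𝒢.Gv w) (m : ℕ) : P.gal n (h ^ m) = P.gal n h ^ m := by
  rw [← P.proj_decompHom, ← P.proj_decompHom, map_pow, map_pow]

/-- **The order of `σ_n^h` does not depend on the point sequence over `w`.**
[cite: MochizukiSemiAnbd2006, Thm 3.7(i) p.40] -/
theorem orderOf_gal_eq (P' : D.PointSeq h𝒢 w) (n : ℕ) (h : 𝒢.Gv w) :
    orderOf (P.gal n h) = orderOf (P'.gal n h) := by
  rw [orderOf_eq_orderOf_iff]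
  intro m
  rw [← P.gal_pow, ← P'.gal_pow]
  exact P.gal_eq_one_iff_gal_eq_one P' n (h ^ m)

/-! ### Transfer through the gluing: the edge group -/

/-- **`σ_n^{b_*(t)} = 1` iff `t ∈ Π_e` fixes a point of the edge fibre `(𝒢_{∞,n})_e`** (`e` the edge of
`b`, ANY point `s`): the gluing `S_e ≅ b^* S_w` is `b_*`-equivariant and all point stabilisers over `w`
agree.  In particular the condition is the same for the two branches of `e`.
[cite: MochizukiSemiAnbd2006, Def 3.5(i) p.37] -/
theorem gal_brHom_eq_one_iff_ρE (n : ℕ) (b : 𝒢.graph.Branch) (hb : 𝒢.graph.abuts b = some w)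
    (t : 𝒢.Ge (𝒢.graph.edgeOf b)) (s : ((D.cover h𝒢 n).SE (𝒢.graph.edgeOf b)).obj.V) :
    P.gal n (𝒢.brHom b w hb t) = 1 ↔ ((D.cover h𝒢 n).SE (𝒢.graph.edgeOf b)).obj.ρ t s = s := by
  rw [P.gal_eq_one_iff, D.ρ_eq_self_iff_of_cover h𝒢 n w (𝒢.brHom b w hb t) (P.pt n)
    (((D.cover h𝒢 n).glue b w hb).hom.hom.hom s)]
  constructor
  · intro h
    apply Function.LeftInverse.injective ((D.cover h𝒢 n).glue_inv_hom b w hb)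
    rw [(D.cover h𝒢 n).glue_ρ b w hb t s]
    exact h
  · intro h
    rw [← (D.cover h𝒢 n).glue_ρ b w hb t s, h]

/-! ### The re-centred branch-stabiliser dictionary -/

/-- **Re-centred branch-stabiliser lemma, cover coordinates.**  For a branch `β₀` of the underlying
semi-graph of `𝒢_{∞,n}` over `b` abutting to the orbit of `P.pt n`, there is a point sequence `P'` over `w`
(a `Π_w`-translate of `P`, through the point of `β₀`) such that EVERY `σ ∈ Aut(𝒢_{∞,n})` fixing `β₀` is
`σ = σ_n^{b_*(k)}` (w.r.t. `P'`) for some `k ∈ Π_e`. [cite: MochizukiSemiAnbd2006, Rmk 2.2.1 p.24] -/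
theorem exists_pointSeq_forall_stab_branch (n : ℕ) (b : 𝒢.graph.Branch)
    (hb : 𝒢.graph.abuts b = some w) (β₀ : (D.cover h𝒢 n).orbitGraph.Branch) (hβ₀b : β₀.1.1 = b)
    (hβ₀ : (D.cover h𝒢 n).orbitGraph.abuts β₀ = some (Quot.mk _ ⟨w, P.pt n⟩)) :
    ∃ P' : D.PointSeq h𝒢 w, ∀ σ : D.Gal h𝒢 n, (CovObj.orbitGraphMap σ.hom).branchMap β₀ = β₀ →
      ∃ k : 𝒢.Ge (𝒢.graph.edgeOf b), σ = P'.gal n (𝒢.brHom b w hb k) := by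
  -- `β₀ = brOf b y` for a point `y ∈ (𝒢_{∞,n})_w`, and `y = g · P.pt n`
  obtain ⟨y, rfl⟩ := (D.cover h𝒢 n).exists_eq_brOf b hb β₀ hβ₀b
  rw [(D.cover h𝒢 n).abuts_brOf b hb y] at hβ₀
  obtain ⟨g, hg⟩ := (D.cover h𝒢 n).exists_ρ_of_mk_eq_mk (Option.some.inj hβ₀).symm
  -- the translated point sequence `g · P`, through `y` at level `n`
  let P' : D.PointSeq h𝒢 w :=
    ⟨fun m => ((D.cover h𝒢 m).SV w).obj.ρ g (P.pt m), fun m => by rw [D.stepCover_ρ h𝒢, P.compat]⟩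
  have hP' : P'.pt n = y := hg
  refine ⟨P', fun σ hfix => ?_⟩
  rw [(D.cover h𝒢 n).branchMap_brOf b hb σ y, (D.cover h𝒢 n).brOf_eq_brOf_iff b hb] at hfix
  obtain ⟨k', ⟨k, rfl⟩, hk⟩ := hfix
  have hk' : (𝒢.brHom b w hb).toMonoidHom k = 𝒢.brHom b w hb k := rfl
  rw [hk'] at hk
  refine ⟨k, P'.eq_gal n _ σ ?_⟩
  rw [hP']
  -- `hk : b_*(k) · σ y = y`, hence `σ y = b_*(k)⁻¹ · y`
  calc (σ.hom.fV w).hom.hom y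
      = ((D.cover h𝒢 n).SV w).obj.ρ (𝒢.brHom b w hb k)⁻¹
          (((D.cover h𝒢 n).SV w).obj.ρ (𝒢.brHom b w hb k) ((σ.hom.fV w).hom.hom y)) :=
        (ρ_inv_apply _ _ _).symm
    _ = ((D.cover h𝒢 n).SV w).obj.ρ (𝒢.brHom b w hb k)⁻¹ y := by rw [hk]

/-- **Re-centred branch-stabiliser lemma, tree coordinates** ([SemiAnbd] Rmk 2.2.1 at one level, no
finiteness): for a branch `β` of `𝔾̃_n` at `P.vertex n` over the branch `b` of `𝔾` (abutting to `w`) there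
is ONE point sequence `P'` over `w` such that every `g ∈ π₁^temp(𝒢)` fixing the EDGE of `β` at level `n` has
level-`n` component `σ_n^{b_*(k)}` (w.r.t. `P'`) for some `k ∈ Π_e`: the whole stabiliser of the edge lies
in the image of one copy of the branch group `Π_b`. [cite: MochizukiSemiAnbd2006, Rmk 2.2.1 p.24] -/
theorem exists_pointSeq_forall_fix_edge (n : ℕ) (b : 𝒢.graph.Branch)
    (hb : 𝒢.graph.abuts b = some w) (β : (D.tree n).Branch) (hβb : (D.treeProj n).branchMap β = b)
    (hβ : (D.tree n).abuts β = some (P.vertex n)) :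
    ∃ P' : D.PointSeq h𝒢 w, ∀ g : D.temperedPi h𝒢,
      (D.treeAct h𝒢 n g).hom.edgeMap ((D.tree n).edgeOf β) = (D.tree n).edgeOf β →
      ∃ k : 𝒢.Ge (𝒢.graph.edgeOf b), D.proj h𝒢 n g = P'.gal n (𝒢.brHom b w hb k) := by
  set β₀ := (D.treeIso h𝒢 n).inv.branchMap β with hβ₀
  have hβeq : β = (D.treeIso h𝒢 n).hom.branchMap β₀ := (D.treeIso_hom_branchMap_inv h𝒢 n β).symm
  have hβ₀b : β₀.1.1 = b := by rw [← hβb, hβeq, D.treeProj_branchMap_treeIso h𝒢]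
  have hβ₀a : (D.cover h𝒢 n).orbitGraph.abuts β₀ = some (Quot.mk _ ⟨w, P.pt n⟩) := by
    apply D.orbitGraph_abuts_of_tree_abuts h𝒢
    rw [← hβeq]
    exact hβ
  obtain ⟨P', hP'⟩ := P.exists_pointSeq_forall_stab_branch n b hb β₀ hβ₀b hβ₀a
  refine ⟨P', fun g hfix => ?_⟩
  have hfixβ : (D.treeAct h𝒢 n g).hom.branchMap β = β :=
    SemiGraph.branchMap_eq_of_over_aut (D.treeProj n) (D.treeAct h𝒢 n g) (D.treeAct_over h𝒢 n g) β hfix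
  refine hP' (D.proj h𝒢 n g) ?_
  have h1 := hfixβ
  rw [D.treeAct_apply, hβeq, D.galTreeAct_branchMap_treeIso h𝒢] at h1
  have h2 := congrArg (D.treeIso h𝒢 n).inv.branchMap h1
  rw [D.treeIso_inv_branchMap_hom h𝒢, D.treeIso_inv_branchMap_hom h𝒢] at h2
  exact h2

/-- Corollary: **the level-`n` image of the stabiliser of the edge of `β` is contained in ONE cyclic
group** when `Π_e` is topologically generated by one element `t₀`: every `g ∈ π₁^temp(𝒢)` fixing the edge has
`ρ_n(g) ∈ ⟨σ_n^{b_*(t₀)}⟩` (w.r.t. the re-centred point sequence). [cite: MochizukiSemiAnbd2006, Rmk 2.2.1 p.24] -/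
theorem exists_pointSeq_forall_fix_edge_mem_zpowers (n : ℕ) (b : 𝒢.graph.Branch)
    (hb : 𝒢.graph.abuts b = some w) (β : (D.tree n).Branch) (hβb : (D.treeProj n).branchMap β = b)
    (hβ : (D.tree n).abuts β = some (P.vertex n)) (t₀ : 𝒢.Ge (𝒢.graph.edgeOf b))
    (hgen : (Subgroup.zpowers t₀).topologicalClosure = ⊤) :
    ∃ P' : D.PointSeq h𝒢 w, ∀ g : D.temperedPi h𝒢,
      (D.treeAct h𝒢 n g).hom.edgeMap ((D.tree n).edgeOf β) = (D.tree n).edgeOf β →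
      D.proj h𝒢 n g ∈ Subgroup.zpowers (P'.gal n (𝒢.brHom b w hb t₀)) := by
  obtain ⟨P', hP'⟩ := P.exists_pointSeq_forall_fix_edge n b hb β hβb hβ
  refine ⟨P', fun g hfix => ?_⟩
  obtain ⟨k, hk⟩ := hP' g hfix
  -- the continuous homomorphism `Π_e → Gal_n`, `t ↦ σ_n^{b_*(t)}`
  let τ : 𝒢.Ge (𝒢.graph.edgeOf b) →* D.Gal h𝒢 n :=
    ((D.proj h𝒢 n).comp P'.decompHom).comp (𝒢.brHom b w hb).toMonoidHom
  have hτ : Continuous τ :=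
    ((D.continuous_proj h𝒢 n).comp P'.continuous_decompHom).comp (𝒢.brHom b w hb).continuous
  have hτt : ∀ t, τ t = P'.gal n (𝒢.brHom b w hb t) := fun t => rfl
  have hrange : τ.range = Subgroup.zpowers (τ t₀) := MonoidHom.range_eq_zpowers_of_dense t₀ hgen τ hτ
  rw [← hτt, ← hrange, hk, ← hτt k]
  exact ⟨k, rfl⟩

end PointSeq

end GaloisLevelData

end ProfiniteSemiGraph

end Literature.AnabelianGeometry.SemiGraphs
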